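import Mathlib.RepresentationTheory.Irreducible
import Literature.NumberTheory.Automorphic.RestrictedTensorProductIrreducibleProofs
import HarnessLib

/-!
# Isotypic placement of an equivariant map out of an irreducible (restricted tensor product) representation

Topic `NumberTheory/Automorphic`; KERNEL glue, no print records (pub-hodgecm model-construction cell,
node AX2-c, memo `AX2c-shapes.md` §1 N-f2/N-f3).

## What is proved

1. `IsRestrictedTensorProductRep.isIrreducible_of_irreducible_admissible` — Flath's theorem (easy
   direction) WITHOUT the spherical hypothesis `hsph` of the named fact
   `IsRestrictedTensorProductRep.isIrreducible` (`RestrictedTensorProduct.lean`): a restricted tensor product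
   `(W, π, j)` of irreducible admissible representations of locally profinite groups (compact open `K i`)
   over an algebraically closed field is irreducible.  The tree proof `isIrreducible_holds`
   (`RestrictedTensorProductIrreducibleProofs.lean`) never uses `hsph` ("The spherical hypothesis is not
   needed for irreducibility, only for admissibility", loc. cit.); the argument is repeated here verbatim
   minus that binder, with credit, so that consumers whose local factors are irreducible admissible but
   whose sphericity (a Gelfand-pair statement) is not in the kernel can use it.
2. `Representation.IntertwiningMap.comp_eq_zero_of_forall_isEmpty_equiv` /
   `….range_le_ker_of_forall_isEmpty_equiv` — SCHUR PLACEMENT: if `ρ` is irreducible, `T : ρ → σ` and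
   `p : σ → τ` are intertwining maps and NO subrepresentation of `τ` is equivalent to `ρ`, then
   `p ∘ T = 0`, i.e. `range T ≤ ker p`.  (With `p` the projection of `H¹_B` onto the complement of the
   `ω_i`-isotypic part, this places the classes of an equivariant class map out of `ω_i` inside the
   `ω_i`-isotypic part; Mathlib's module-theoretic form is `LinearMap.le_comap_isotypicComponent`.)
3. `Representation.IntertwiningMap.equivRange` — an injective intertwining map is an equivalence onto its
   range (the constructor used in 2).

## References

* D. Flath, *Decomposition of representations into tensor products*, Proc. Sympos. Pure Math. 33 (1979),
  part 1, 179–183, Theorem 2 / Example 2 [FlathCorvallis1979] — via the tree file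
  `RestrictedTensorProductIrreducibleProofs.lean` whose lemmas (`piTensorProduct_submodule_eq_top`,
  `Representation.exists_asAlgebraHom_apply_eq`, `Representation.IsAdmissible.exists_eq_smul_id`,
  `IsRestrictedMultilinear.monotone_range_liftFinset`, `….liftFinset_map_eq`) are reused by name.
* Mathlib `RepresentationTheory/Intertwining.lean`, `Irreducible.lean` (`IntertwiningMap`, `range`, `ker`,
  `Representation.Equiv.mk`, `Representation.IsIrreducible.injective_or_eq_zero`).
-/

open Module Filter PiTensorProduct
open scoped RestrictedProduct TensorProduct

/-! ## 1. Schur placement (pure representation theory over Mathlib) -/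

namespace Representation.IntertwiningMap

universe ua ug uv uw uu

section Monoid

variable {A : Type ua} {G : Type ug} {V : Type uv} {W : Type uw}
  [CommSemiring A] [Monoid G] [AddCommMonoid V] [AddCommMonoid W] [Module A V] [Module A W]
  {ρ : Representation A G V} {σ : Representation A G W}

/-- An injective intertwining map `f : ρ → σ` is an equivalence of `ρ` onto the subrepresentation
`f.range` of `σ`. [folklore] -/
noncomputable def equivRange (f : IntertwiningMap ρ σ) (hf : Function.Injective f) :
    ρ.Equiv f.range.toRepresentation :=
  Representation.Equiv.mk (LinearEquiv.ofInjective f.toLinearMap hf) fun g =>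
    LinearMap.ext fun v => Subtype.ext (by
      change f (ρ g v) = σ g (f v)
      exact IntertwiningMap.isIntertwining ρ σ f g v)

/-- `equivRange f hf v = f v` in `W`. [folklore] -/
theorem equivRange_apply (f : IntertwiningMap ρ σ) (hf : Function.Injective f) (v : V) :
    ((equivRange f hf v : f.range.toSubmodule) : W) = f v := rfl

end Monoid

section Field

variable {k : Type ua} {G : Type ug} {V : Type uv} {W : Type uw} {U : Type uu}
  [Field k] [Monoid G] [AddCommGroup V] [AddCommGroup W] [AddCommGroup U]
  [Module k V] [Module k W] [Module k U]
  {ρ : Representation k G V} {σ : Representation k G W} {τ : Representation k G U}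

/-- The `k[G]`-linear equivalence of the `asModule`s underlying an equivalence of representations
(Mathlib's `equivLinearMapAsModule` in both directions). [folklore] -/
noncomputable def asModuleLinearEquiv (e : ρ.Equiv σ) :
    ρ.asModule ≃ₗ[MonoidAlgebra k G] σ.asModule :=
  { equivLinearMapAsModule ρ σ e.toIntertwiningMap with
    invFun := equivLinearMapAsModule σ ρ e.symm.toIntertwiningMap
    left_inv := fun v => by
      change e.symm.toIntertwiningMap (e.toIntertwiningMap v) = v
      simp
    right_inv := fun w => by
      change e.toIntertwiningMap (e.symm.toIntertwiningMap w) = w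
      simp }

/-- Irreducibility is invariant under equivalence of representations. [folklore] -/
theorem isIrreducible_of_equiv (e : ρ.Equiv σ) [ρ.IsIrreducible] : σ.IsIrreducible := by
  rw [Representation.irreducible_iff_isSimpleModule_asModule] at *
  exact IsSimpleModule.congr (asModuleLinearEquiv e).symm

/-- **Schur placement, composite form.** If `ρ` is irreducible and no subrepresentation of `τ` is
equivalent to `ρ`, every intertwining map `ρ → τ` vanishes. [folklore] -/
theorem eq_zero_of_forall_isEmpty_equiv [ρ.IsIrreducible] (q : IntertwiningMap ρ τ)
    (hτ : ∀ S : Subrepresentation τ, IsEmpty (ρ.Equiv S.toRepresentation)) : q = 0 := by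
  rcases Representation.IsIrreducible.injective_or_eq_zero q with hq | hq
  · exact ((hτ q.range).false (equivRange q hq)).elim
  · exact hq

/-- **Schur placement.** `ρ` irreducible, `T : ρ → σ`, `p : σ → τ` intertwining, no subrepresentation of
`τ` equivalent to `ρ` ⇒ `range T ≤ ker p`.  (Use: `σ = H¹_B`, `p` = the equivariant projection killing
exactly the `ω_i`-isotypic part, `T` = the theta class map out of `ω_i`.) [folklore] -/
theorem range_le_ker_of_forall_isEmpty_equiv [ρ.IsIrreducible] (T : IntertwiningMap ρ σ)
    (p : IntertwiningMap σ τ) (hτ : ∀ S : Subrepresentation τ, IsEmpty (ρ.Equiv S.toRepresentation)) :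
    T.range ≤ p.ker := by
  have h0 : p.comp T = 0 := eq_zero_of_forall_isEmpty_equiv (p.comp T) hτ
  rintro w ⟨v, rfl⟩
  change p (T v) = 0
  have := DFunLike.congr_fun h0 v
  simpa [comp_apply] using this

/-- Variant with the hypothesis on `τ` phrased through IRREDUCIBLE subrepresentations only: it suffices
that no irreducible subrepresentation of `τ` be equivalent to `ρ` (a subrepresentation equivalent to the
irreducible `ρ` is irreducible, `isIrreducible_of_equiv`). [folklore] -/
theorem range_le_ker_of_forall_irreducible_isEmpty_equiv [ρ.IsIrreducible] (T : IntertwiningMap ρ σ)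
    (p : IntertwiningMap σ τ)
    (hτ : ∀ S : Subrepresentation τ, S.toRepresentation.IsIrreducible →
      IsEmpty (ρ.Equiv S.toRepresentation)) :
    T.range ≤ p.ker :=
  range_le_ker_of_forall_isEmpty_equiv T p fun S =>
    ⟨fun e => (hτ S (isIrreducible_of_equiv e)).false e⟩

end Field

end Representation.IntertwiningMap

/-! ## 2. Flath irreducibility without the spherical binder -/

namespace Literature.NumberTheory.Automorphic

universe u uk uG v w

section Irreducible

variable {ι : Type u} {k : Type uk} [Field k] {G : ι → Type uG} [∀ i, Group (G i)]
  {K : ∀ i, Subgroup (G i)} {V : ι → Type v} [∀ i, AddCommGroup (V i)] [∀ i, Module k (V i)]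
  {ρ : ∀ i, Representation k (G i) (V i)} {x₀ : ∀ i, V i} [DecidableEq ι]
  {W : Type w} [AddCommGroup W] [Module k W] {π : Representation k (Πʳ i, [G i, K i]) W}
  {hx₀ : ∀ᶠ i in cofinite, x₀ i ∈ (ρ i).fixedPoints (K i)}
  {j : RestrictedFamily V x₀ → W} {S₀ : Finset ι} [∀ i, TopologicalSpace (G i)]

/-- **Flath's theorem (easy direction) without the spherical hypothesis.** Over an algebraically closed
field, a restricted tensor product `(W, π, j)` of irreducible ADMISSIBLE representations `ρ i` of locally
profinite groups `G i` (compact open `K i`) is irreducible.  Same proof as the tree's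
`IsRestrictedTensorProductRep.isIrreducible_holds` (which introduces and discards `hsph`), repeated
without that binder. (Flath 1979, Theorem 2 with Example 2; Bump 1997, Prop. 3.4.9, Thm. 3.4.4.)
[cite: FlathCorvallis1979, Theorem 2 / Example 2] -/
theorem IsRestrictedTensorProductRep.isIrreducible_of_irreducible_admissible
    [IsAlgClosed k] [∀ i, NonarchimedeanGroup (G i)] [∀ i, LocallyCompactSpace (G i)]
    [∀ i, T2Space (G i)] (hK : ∀ i, IsOpen (K i : Set (G i)))
    (hKc : ∀ i, IsCompact (K i : Set (G i))) (hirr : ∀ i, (ρ i).IsIrreducible)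
    (hρ : ∀ i, (ρ i).IsAdmissible) (h : IsRestrictedTensorProductRep ρ π hx₀ j S₀) :
    π.IsIrreducible := by
  obtain ⟨hj, hinj, hsup⟩ := h.isRestrictedTensorProduct
  have hequiv := h.map_smul
  have hd : ∀ (i : ι) (s : Finset (V i)) (f : V i →ₗ[k] V i),
      ∃ r : MonoidAlgebra k (G i), ∀ m ∈ s, (ρ i).asAlgebraHom r m = f m := fun i =>
    haveI := hirr i
    Representation.exists_asAlgebraHom_apply_eq
      fun T hT => (hρ i).exists_eq_smul_id (hK i) (hKc i) T hT
  haveI hVnt : ∀ i, Nontrivial (V i) := fun i =>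
    haveI := hirr i
    Representation.IsIrreducible.nontrivial (ρ i)
  haveI : Nontrivial W :=
    haveI : Nontrivial (⨂[k] i : S₀, V i) := piTensorProduct_nontrivial
    (hinj S₀ subset_rfl).nontrivial
  have hmono : Monotone fun S : Finset ι => LinearMap.range (hj.liftFinset S) :=
    hj.monotone_range_liftFinset
  have hmem : ∀ w : W, ∃ S : Finset ι, w ∈ LinearMap.range (hj.liftFinset S) := fun w =>
    (Submodule.mem_iSup_of_directed _ hmono.directed_le).1 (by rw [hsup]; exact Submodule.mem_top)
  refine { toNontrivial := ⟨⟨⊥, ⊤, fun hbt => ?_⟩⟩, eq_bot_or_eq_top := fun U => ?_ }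
  · exact bot_ne_top (congrArg Subrepresentation.toSubmodule hbt)
  by_cases hU : U = ⊥
  · exact Or.inl hU
  refine Or.inr (Subrepresentation.toSubmodule_injective (Submodule.eq_top_iff'.2 fun w => ?_))
  have hU' : U.toSubmodule ≠ ⊥ := fun h' => hU (Subrepresentation.toSubmodule_injective h')
  obtain ⟨u, huU, hu0⟩ := Submodule.exists_mem_ne_zero_of_ne_bot hU'
  obtain ⟨S₁, hu⟩ := hmem u
  obtain ⟨S₂, hw⟩ := hmem w
  obtain ⟨S, hS₁, hS₂⟩ : ∃ S : Finset ι, S₁ ⊆ S ∧ S₂ ⊆ S :=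
    ⟨S₁ ∪ S₂, Finset.subset_union_left, Finset.subset_union_right⟩
  obtain ⟨t₀, rfl⟩ : u ∈ LinearMap.range (hj.liftFinset S) := hmono hS₁ hu
  obtain ⟨t₁, rfl⟩ : w ∈ LinearMap.range (hj.liftFinset S) := hmono hS₂ hw
  let U' : Submodule k (⨂[k] i : S, V i) := U.toSubmodule.comap (hj.liftFinset S)
  have hstab : ∀ (g : ∀ i : S, G i), ∀ t ∈ U', map (fun i : S => ρ i (g i)) t ∈ U' := by
    intro g t ht
    let g' : Πʳ i, [G i, K i] :=
      RestrictedProduct.mk (fun i => if hi : i ∈ S then g ⟨i, hi⟩ else 1)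
        (S.eventually_cofinite_notMem.mono fun i hi => by simp [hi])
    have hg' : (fun i : S => ρ i (g i)) = fun i : S => ρ i (g' i) := by
      funext i
      change ρ i (g i) = ρ i (if hi : (i : ι) ∈ S then g ⟨i, hi⟩ else 1)
      rw [dif_pos i.2]
    have hg'' : ∀ i ∉ S, ρ i (g' i) (x₀ i) = x₀ i := fun i hi => by
      change ρ i (if hi : (i : ι) ∈ S then g ⟨i, hi⟩ else 1) (x₀ i) = x₀ i
      rw [dif_neg hi, map_one, Module.End.one_apply]
    change hj.liftFinset S (map (fun i : S => ρ i (g i)) t) ∈ U.toSubmodule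
    rw [hg', hj.liftFinset_map_eq hequiv S g' hg'' t]
    exact U.apply_mem_toSubmodule g' ht
  have hU'0 : U' ≠ ⊥ := by
    intro hbot
    have ht₀ : t₀ ∈ U' := huU
    rw [hbot, Submodule.mem_bot] at ht₀
    exact hu0 (by rw [ht₀, map_zero])
  have hU'top : U' = ⊤ :=
    piTensorProduct_submodule_eq_top (fun i : S => ρ i) (fun i => hd i) hstab hU'0
  have ht₁ : t₁ ∈ U' := hU'top ▸ Submodule.mem_top
  exact ht₁

end Irreducible

end Literature.NumberTheory.Automorphic
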